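import Summits.BirchSwinnertonDyer.BirchSwinnertonDyer.Theorems.ResidualThetaTransportAtTwoHeckeThetaHigherWeightAssembly
import Summits.BirchSwinnertonDyer.BirchSwinnertonDyer.Theses.ResidualThetaTransportAtTwo
import Literature.NumberTheory.EllipticCurves.CMNewformGamma0OfGrossencharakterProofs
import HarnessLib

/-!
# `Ribet1977_cmNewform_gamma0_of_isGrossencharakter` PROVED: Hecke's weight-`k` theta series ⇒ the
# `Γ₀(N)`-CM-newform of a Größencharakter with trivial Nebentypus (item stmt-BirchSwinnertonDyer-24141)

Route `ResidualThetaTransportAtTwo`; item `RibetCMNewformGammaZeroSupply` (stmt-BirchSwinnertonDyer-24141) is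
the by-name alias of the Literature fact `Ribet1977_cmNewform_gamma0_of_isGrossencharakter`.  THEOREMS ONLY.
Prepared by the literature-prover seat `bsd-input-ribet77-cm-newform-g0` as EVIDENCE (Summit `Theorems/`
is prover-only); compiles against the tree of 2026-08-28 after the five `…HeckeThetaHigherWeight*` files.

* `heckeThetaCuspForm_of_isGrossencharakter` — **X_k for every even `k ≥ 2`**: for an imaginary quadratic
  `K`, `𝔪 ≠ 0`, and the prime values `ψ` of a Größencharakter mod `𝔪` of type `(k-1, 0)` at `σ` whose
  values on odd naturals `n` prime to `|d_K| N𝔪` are `(d_K/n) n^{k-1}`, the series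
  `Σ_n (Σ_{N𝔞 = n, (𝔞,𝔪)=1} ψ̃(𝔞)) qⁿ` is a cusp form of weight `k` on `Γ₀(|d_K|·N𝔪)`
  (`exists_heckeTheta_cuspForm_pow` with `e = k - 1` odd; the Kronecker character from
  `Literature…exists_kroneckerChar_odd_jacobiSym_dedekindZeta`, the weight-`k` ray relation from
  `Literature…idealPow_span_eq_of_isGrossencharakter_weight`);
* `ribet1977_cmNewform_gamma0_of_isGrossencharakter_proof` — the Literature fact, by
  `Literature…Ribet1977_cmNewform_gamma0_of_isGrossencharakter_of_heckeTheta` (p666423);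
* `ribetCMNewformGammaZeroSupply_proof` — the route item.

No statement of BSD is proved by this file.
-/

set_option autoImplicit false
set_option linter.dupNamespace false

noncomputable section

open scoped NumberField ComplexConjugate Real MatrixGroups UpperHalfPlane ModularForm nonZeroDivisors
open NumberField Module Matrix Complex Filter IsDedekindDomain CongruenceSubgroup

namespace Summit.BirchSwinnertonDyer.BirchSwinnertonDyer.Theorems.HeckeTheta

open Literature.Analysis.SpecialFunctions
open Literature.NumberTheory.ModularForms.BinaryTheta
open Literature.NumberTheory.LFunctions (idealPow rayClassCoeff idealPow_top)
open Literature.NumberTheory.GaloisRepresentations (IsGrossencharakter embType embTypeConj)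
open Literature.NumberTheory.EllipticCurves.ModularForms (exists_kroneckerChar_odd_jacobiSym_dedekindZeta
  idealPow_span_eq_of_isGrossencharakter_weight Ribet1977_cmNewform_gamma0_of_isGrossencharakter
  Ribet1977_cmNewform_gamma0_of_isGrossencharakter_of_heckeTheta)

/-- **X_k (every even `k ≥ 2`): Hecke's theta series of a Größencharakter of type `(k-1, 0)` with trivial
Nebentypus is a cusp form of weight `k` on `Γ₀(|d_K|·N𝔪)` with `q`-expansion `Σ_{(𝔞,𝔪)=1} ψ̃(𝔞) q^{N𝔞}`.** -/
theorem heckeThetaCuspForm_of_isGrossencharakter :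
    ∀ (K : Type) [Field K] [NumberField K], finrank ℚ K = 2 → IsTotallyComplex K →
      ∀ (σ : K →+* ℂ) (k : ℕ), 2 ≤ k → Even k →
      ∀ (𝔪 : Ideal (𝓞 K)), 𝔪 ≠ ⊥ →
      ∀ (ψ : HeightOneSpectrum (𝓞 K) → ℂ),
        IsGrossencharakter 𝔪 (fun w => ((k : ℤ) - 1) * embType σ w)
          (fun w => ((k : ℤ) - 1) * embTypeConj σ w) ψ →
        (∀ n : ℕ, Odd n → n.Coprime ((discr K).natAbs * Ideal.absNorm 𝔪) →
          idealPow K ψ (Ideal.span {(n : 𝓞 K)}) = (jacobiSym (discr K) n : ℂ) * (n : ℂ) ^ (k - 1)) →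
        ∃ g : CuspForm (Gamma0 ((discr K).natAbs * Ideal.absNorm 𝔪)) (k : ℤ), ∀ τ : ℍ,
          HasSum (fun n : ℕ => (∑ᶠ J ∈ {J : Ideal (𝓞 K) | Ideal.absNorm J = n}, rayClassCoeff 𝔪 ψ J) *
            cexp (2 * π * I * (τ : ℂ)) ^ n) (g τ) := by
  intro K _ _ hK htc σ k hk hkev 𝔪 h𝔪 ψ hψG hneb
  classical
  haveI := htc
  obtain ⟨e, rfl⟩ : ∃ e, k = e + 1 := ⟨k - 1, by omega⟩
  have he : Odd e := by
    rcases Nat.even_or_odd e with h | h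
    · exfalso
      obtain ⟨r, hr⟩ := hkev
      obtain ⟨s, hs⟩ := h
      omega
    · exact h
  haveI : NeZero (discr K).natAbs := ⟨Int.natAbs_ne_zero.mpr (NumberField.discr_ne_zero K)⟩
  have hM : Ideal.absNorm 𝔪 ≠ 0 := by rw [Ne, Ideal.absNorm_eq_zero_iff]; exact h𝔪
  haveI hN₀ : NeZero ((discr K).natAbs * Ideal.absNorm 𝔪) := ⟨mul_ne_zero (NeZero.ne _) hM⟩
  -- the Kronecker character
  obtain ⟨κ, hprim, hodd, hquad, hκJ, hζ⟩ := exists_kroneckerChar_odd_jacobiSym_dedekindZeta (K := K) hK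
  -- the weight-`k` Größencharakter relation on the ray
  have hψ : ∀ b c : 𝓞 K, b ≠ 0 → c ≠ 0 → IsCoprime (Ideal.span {c}) 𝔪 → b - c ∈ 𝔪 →
      idealPow K ψ (Ideal.span {b}) = idealPow K ψ (Ideal.span {c}) * σ ((b : K) / c) ^ e := by
    intro b c hb hc hcop hbc
    have h := idealPow_span_eq_of_isGrossencharakter_weight σ (e + 1) hψG b c hb hc hcop hbc
    rw [h]
    congr 1
    rw [show ((((e + 1 : ℕ) : ℤ)) - 1) = ((e : ℕ) : ℤ) by push_cast; ring, zpow_natCast]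
  have hψ0 : ∀ v : HeightOneSpectrum (𝓞 K), ¬ 𝔪 ≤ v.asIdeal → ψ v ≠ 0 := hψG.ne_zero
  -- the modulus is not `1`: `ψ̃((-1)) = ψ̃((1)) σ(-1)ᵉ = -1` is impossible
  have h𝔪1 : 𝔪 ≠ ⊤ := by
    intro h𝔪T
    have h := hψ (-1) 1 (by simp) one_ne_zero
      (by rw [Ideal.span_singleton_one, ← Ideal.one_eq_top]; exact isCoprime_one_left) (by rw [h𝔪T]; trivial)
    rw [Ideal.span_singleton_neg, Ideal.span_singleton_one, idealPow_top] at h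
    have hσ : σ (((-1 : 𝓞 K) : K) / ((1 : 𝓞 K) : K)) = -1 := by simp
    rw [hσ, he.neg_one_pow] at h
    norm_num at h
  -- the clause at weight `e + 1`
  have hneb' : ∀ n : ℕ, Odd n → n.Coprime ((discr K).natAbs * Ideal.absNorm 𝔪) →
      idealPow K ψ (Ideal.span {(n : 𝓞 K)}) = (jacobiSym (discr K) n : ℂ) * (n : ℂ) ^ e := by
    intro n hn hc
    rw [hneb n hn hc, Nat.add_sub_cancel]
  exact exists_heckeTheta_cuspForm_pow hK σ hprim hodd hquad hκJ hζ h𝔪 h𝔪1 he hψ0 hψ hneb'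

/-- **The Literature fact `Ribet1977_cmNewform_gamma0_of_isGrossencharakter`, proved** (Hecke's theta
series at every even weight; odd weights are vacuous by the trivial-Nebentypus clause). -/
theorem ribet1977_cmNewform_gamma0_of_isGrossencharakter_proof :
    Ribet1977_cmNewform_gamma0_of_isGrossencharakter :=
  Ribet1977_cmNewform_gamma0_of_isGrossencharakter_of_heckeTheta heckeThetaCuspForm_of_isGrossencharakter

end Summit.BirchSwinnertonDyer.BirchSwinnertonDyer.Theorems.HeckeTheta

namespace Summit.BirchSwinnertonDyer.BirchSwinnertonDyer.Theorems

/-- **Item stmt-BirchSwinnertonDyer-24141 (`RibetCMNewformGammaZeroSupply`), proved.** -/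
theorem ribetCMNewformGammaZeroSupply_proof : Theses.ResidualThetaTransportAtTwo.RibetCMNewformGammaZeroSupply :=
  HeckeTheta.ribet1977_cmNewform_gamma0_of_isGrossencharakter_proof

end Summit.BirchSwinnertonDyer.BirchSwinnertonDyer.Theorems

end
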